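import Mathlib
import HarnessLib
import HarnessLib.Audit
import Summits.Langlands.Statement
import Summits.Langlands.Langlands.Theses.RootDecomp1
import Summits.Langlands.Langlands.Theses.IwahoriBlockSplit
import Summits.Langlands.Langlands.Theses.SphericalRigiditySplit
set_option linter.dupNamespace false
set_option linter.unusedVariables false
set_option linter.unusedSectionVars false

/-!
# Birth skeleton (BC3) for crux `SphericalRigiditySplit.UnramifiedCompatibleAvatar` — line `birth` (PRE-BIRTH form: the cell is a local def with the
route text VERBATIM; after birth replace it by the route decl `Summit.Langlands.Langlands.Theses.SphericalRigiditySplit.UnramifiedCompatibleAvatar`).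
Node `SphericalRigiditySplit` (decomp-langlands lens-2 g23; depth-2 child route refining `IwahoriBlockSplit:IwahoriBlockMatching` stmt-Langlands-28113).
Shape: stubs `theorem stub_<name> : <signature> := by sorry` (each a genuine lemma of the line — no stub restates the cell, IW or the summit:
probes `probes_stubs_UnramifiedCompatibleAvatar.lean`), `namespace _Goal` naming each stub statement, and the kernel-checked composition
`UnramifiedCompatibleAvatar_of … : <the crux>`.  `lean check --json`: rc 0, sorries = the stubs (2), none elsewhere.
-/

open scoped BigOperators Topology Manifold Classical MeasureTheory ProbabilityTheory Matrix InnerProductSpace ComplexConjugate ContinuousMap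
open Filter Set Function TopologicalSpace MeasureTheory

namespace Summit.Langlands.Langlands.Cruxes.UnramifiedCompatibleAvatar.Birth

-- (writer-1 g7, post-birth) the local `def UnramifiedCompatibleAvatar` (pre-birth form, text VERBATIM = the route statement, identity asserted) is REMOVED; the composition below concludes the ROUTE DECL BY NAME.

/-- stub · `stub_fullRangeAvatarLGC` — UCA with FULL local–global compatibility (Taylor Conj. 7: `LocalGlobalCompatibleAt Rec ι π.1 ρ v`, monodromy included) at the exceptional spherical-up-to-twist places v ∤ ℓ of ONE a.e.-compatible avatar ρ_π — what every CONSTRUCTION of avatars with full unramified range delivers after a global twist (Grunwald–Wang + rec's twist axiom): Deligne/Carayol (GL₂ holomorphic), Rogawski–Tunnell / Jarvis 1997 (parallel & partial weight one HMF), HLTT 2016 + Varma 2024 (RA ∧ CM/TR), Goldring–Koskivirta 2019 (U(2,1) non-holomorphic LDS: unramified compatibility); est. XL (E-type existence: barrier-bound outside the construction sectors). -/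
theorem stub_fullRangeAvatarLGC :
    ∀ (K : Type) [Field K] [NumberField K], Nonempty (ReciprocityData K) → ∃ Rec : ReciprocityData K, ∀ (n : ℕ) (hcpt : Literature.NumberTheory.Automorphic.isCompact_glFiniteIntegralLevel n K), 0 < n → ∀ (π : Literature.NumberTheory.Automorphic.CuspidalAutomorphicRepData n K hcpt), π.1.IsLAlgebraic → ∀ (ℓ : ℕ) [Fact ℓ.Prime] (ι : PadicAlgCl ℓ ≃+* ℂ), ∃ ρ : Literature.NumberTheory.GaloisRepresentations.FramedGaloisRep K (PadicAlgCl ℓ) n, (∀ᶠ v : IsDedekindDomain.HeightOneSpectrum (NumberField.RingOfIntegers K) in cofinite, SatakeFrobCompatibleAt ι π.1 ρ v) ∧ ∀ v : IsDedekindDomain.HeightOneSpectrum (NumberField.RingOfIntegers K), ((ℓ : ℕ) : NumberField.RingOfIntegers K) ∉ v.asIdeal → ¬ SatakeFrobCompatibleAt ι π.1 ρ v → (∃ (πv : Literature.NumberTheory.Automorphic.SmoothIrrep (Matrix.GeneralLinearGroup (Fin n) (v.adicCompletion K))), π.1.HasLocalComponentAt v πv.ρ ∧ ∃ χ : Matrix.GeneralLinearGroup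 (Fin n) (v.adicCompletion K) →* ℂˣ, IsOpen (χ.ker : Set (Matrix.GeneralLinearGroup (Fin n) (v.adicCompletion K))) ∧ ∃ w : πv.V, w ≠ 0 ∧ ∀ g ∈ Literature.NumberTheory.Automorphic.glInt n (v.adicCompletion K), (πv.ρ.twist χ) g w = w) → LocalGlobalCompatibleAt Rec ι π.1 ρ v := by
  sorry

/-- stub · `stub_conclOfLGC` — local–global compatibility at v ∤ ℓ ⟹ S's semisimple conclusion (a Frobenius-semisimplification does not change traces: r.ρ w = S.ρ w + nilpotent; tree-style two-liner, PROVABLE NOW — the node's `uca_of_langlands` inlines it). -/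
theorem stub_conclOfLGC :
    ∀ (K : Type) [Field K] [NumberField K] (n : ℕ) (hcpt : Literature.NumberTheory.Automorphic.isCompact_glFiniteIntegralLevel n K) (π : Literature.NumberTheory.Automorphic.CuspidalAutomorphicRepData n K hcpt) (ℓ : ℕ) [Fact ℓ.Prime] (ι : PadicAlgCl ℓ ≃+* ℂ) (Rec : ReciprocityData K) (v : IsDedekindDomain.HeightOneSpectrum (NumberField.RingOfIntegers K)) (ρ : Literature.NumberTheory.GaloisRepresentations.FramedGaloisRep K (PadicAlgCl ℓ) n), ((ℓ : ℕ) : NumberField.RingOfIntegers K) ∉ v.asIdeal → LocalGlobalCompatibleAt Rec ι π.1 ρ v → ∃ (πv : Literature.NumberTheory.Automorphic.SmoothIrrep (Matrix.GeneralLinearGroup (Fin n) (v.adicCompletion K))) (W : Literature.NumberTheory.GaloisRepresentations.WeilDeligneRep (v.adicCompletion K) (PadicAlgCl ℓ) (Fin n → (PadicAlgCl ℓ))) (Wℂ : Literature.NumberTheory.GaloisRepresentations.WeilDeligneRep (v.adicCompletion K) ℂ (Fin n → ℂ)) (S : Literature.NumberTheory.GaloisRepresentations.WeilDeligneRep (v.adicCompletion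 K) ℂ (Fin n → ℂ)) (hS : S.IsFrobSemisimple), π.1.HasLocalComponentAt v πv.ρ ∧ Literature.NumberTheory.GaloisRepresentations.IsWeilDeligneOfLadic (ρ.toLocal v).toWeilGroupHom W ∧ W.IsTransportAlong (ι : PadicAlgCl ℓ →+* ℂ) Wℂ ∧ Quotient.mk (Literature.NumberTheory.Automorphic.frobSemisimpleWDSetoid (v.adicCompletion K) n) ⟨S, hS⟩ = (Rec.llc v).recGL n (Literature.NumberTheory.Automorphic.IrrClass.mk πv) ∧ ∀ w : Literature.NumberTheory.GaloisRepresentations.WeilGroup (v.adicCompletion K), LinearMap.trace ℂ (Fin n → ℂ) (Wℂ.ρ w) = LinearMap.trace ℂ (Fin n → ℂ) (S.ρ w) := by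
  sorry

namespace _Goal

/-- statement of `stub_fullRangeAvatarLGC`. -/
def stub_fullRangeAvatarLGC : Prop :=
  ∀ (K : Type) [Field K] [NumberField K], Nonempty (ReciprocityData K) → ∃ Rec : ReciprocityData K, ∀ (n : ℕ) (hcpt : Literature.NumberTheory.Automorphic.isCompact_glFiniteIntegralLevel n K), 0 < n → ∀ (π : Literature.NumberTheory.Automorphic.CuspidalAutomorphicRepData n K hcpt), π.1.IsLAlgebraic → ∀ (ℓ : ℕ) [Fact ℓ.Prime] (ι : PadicAlgCl ℓ ≃+* ℂ), ∃ ρ : Literature.NumberTheory.GaloisRepresentations.FramedGaloisRep K (PadicAlgCl ℓ) n, (∀ᶠ v : IsDedekindDomain.HeightOneSpectrum (NumberField.RingOfIntegers K) in cofinite, SatakeFrobCompatibleAt ι π.1 ρ v) ∧ ∀ v : IsDedekindDomain.HeightOneSpectrum (NumberField.RingOfIntegers K), ((ℓ : ℕ) : NumberField.RingOfIntegers K) ∉ v.asIdeal → ¬ SatakeFrobCompatibleAt ι π.1 ρ v → (∃ (πv : Literature.NumberTheory.Automorphic.SmoothIrrep (Matrix.GeneralLinearGroup (Fin n) (v.adicCompletion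 K))), π.1.HasLocalComponentAt v πv.ρ ∧ ∃ χ : Matrix.GeneralLinearGroup (Fin n) (v.adicCompletion K) →* ℂˣ, IsOpen (χ.ker : Set (Matrix.GeneralLinearGroup (Fin n) (v.adicCompletion K))) ∧ ∃ w : πv.V, w ≠ 0 ∧ ∀ g ∈ Literature.NumberTheory.Automorphic.glInt n (v.adicCompletion K), (πv.ρ.twist χ) g w = w) → LocalGlobalCompatibleAt Rec ι π.1 ρ v

/-- statement of `stub_conclOfLGC`. -/
def stub_conclOfLGC : Prop :=
  ∀ (K : Type) [Field K] [NumberField K] (n : ℕ) (hcpt : Literature.NumberTheory.Automorphic.isCompact_glFiniteIntegralLevel n K) (π : Literature.NumberTheory.Automorphic.CuspidalAutomorphicRepData n K hcpt) (ℓ : ℕ) [Fact ℓ.Prime] (ι : PadicAlgCl ℓ ≃+* ℂ) (Rec : ReciprocityData K) (v : IsDedekindDomain.HeightOneSpectrum (NumberField.RingOfIntegers K)) (ρ : Literature.NumberTheory.GaloisRepresentations.FramedGaloisRep K (PadicAlgCl ℓ) n), ((ℓ : ℕ) : NumberField.RingOfIntegers K) ∉ v.asIdeal → LocalGlobalCompatibleAt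 Rec ι π.1 ρ v → ∃ (πv : Literature.NumberTheory.Automorphic.SmoothIrrep (Matrix.GeneralLinearGroup (Fin n) (v.adicCompletion K))) (W : Literature.NumberTheory.GaloisRepresentations.WeilDeligneRep (v.adicCompletion K) (PadicAlgCl ℓ) (Fin n → (PadicAlgCl ℓ))) (Wℂ : Literature.NumberTheory.GaloisRepresentations.WeilDeligneRep (v.adicCompletion K) ℂ (Fin n → ℂ)) (S : Literature.NumberTheory.GaloisRepresentations.WeilDeligneRep (v.adicCompletion K) ℂ (Fin n → ℂ)) (hS : S.IsFrobSemisimple), π.1.HasLocalComponentAt v πv.ρ ∧ Literature.NumberTheory.GaloisRepresentations.IsWeilDeligneOfLadic (ρ.toLocal v).toWeilGroupHom W ∧ W.IsTransportAlong (ι : PadicAlgCl ℓ →+* ℂ) Wℂ ∧ Quotient.mk (Literature.NumberTheory.Automorphic.frobSemisimpleWDSetoid (v.adicCompletion K) n) ⟨S, hS⟩ = (Rec.llc v).recGL n (Literature.NumberTheory.Automorphic.IrrClass.mk πv) ∧ ∀ w : Literature.NumberTheory.GaloisRepresentations.WeilGroup (v.adicCompletion K), LinearMap.trace ℂ (Fin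 n → ℂ) (Wℂ.ρ w) = LinearMap.trace ℂ (Fin n → ℂ) (S.ρ w)

end _Goal

/-- COMPOSITION (kernel-checked, no sorry): the stubs give the crux. -/
theorem UnramifiedCompatibleAvatar_of (h₁ : _Goal.stub_fullRangeAvatarLGC) (h₂ : _Goal.stub_conclOfLGC) : Summit.Langlands.Langlands.Theses.SphericalRigiditySplit.UnramifiedCompatibleAvatar := by
  intro K _ _ hne
  obtain ⟨Rec, g⟩ := h₁ K hne
  refine ⟨Rec, fun n hcpt hn π hπ ℓ _ ι => ?_⟩
  obtain ⟨ρ, hae, hv⟩ := g n hcpt hn π hπ ℓ ι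
  exact ⟨ρ, hae, fun v hvℓ hnc hsph => h₂ K n hcpt π ℓ ι Rec v ρ hvℓ (hv v hvℓ hnc hsph)⟩

end Summit.Langlands.Langlands.Cruxes.UnramifiedCompatibleAvatar.Birth
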